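import Literature.AnabelianGeometry.EtaleTheta.SettingModelKummerCocycleP
import Mathlib.Topology.Algebra.OpenSubgroup
import HarnessLib

/-!
# `G_{ℚ_p(μ_N, u^{1/N})} = {χ_N = 1 ∧ κ_u ≡ 0 (N)}` for ANY `G_{ℚ_p}`-fixed unit `u`, and the OPEN SUBGROUP on which the
# stage-2 twisting data `(χ, κ_u^i)` are level-`N`-trivial (the `hloc` input of the χ-twisted semidirect products)
# (R78 cluster of the abc-iut cell, proof-only sibling F3c-4 of F3c / F3c-2)

S. Mochizuki, *The étale theta function …*, Publ. RIMS **45** (2009) [EtTh], §1 p. 13 ("`K_N := K(ζ_N, q_X^{1/N})`",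
"`G_{K_N}`") and p. 17 ("`K̈ = K(ζ₂, q_X^{1/2})`") [cite: MochizukiEtTh2009, §1 p.13]; J. Neukirch, *Algebraic Number
Theory*, Ch. IV §1 (Krull topology: `Gal(K̄/L)` is open for `L/K` finite) and §3 (Kummer theory) [cite: NeukirchANT1999, Ch. IV §3].

abc-iut cell, layer L2, seat abc-iut-L2-t5 (gen 5).  PROOF-ONLY (0 definitions).  F3c proved
`mem_fixingSubgroup_fieldKN_iff` for `q = p²` and the root system `qRoots p`; this file states the same for ANY fixed
unit `u ∈ ℚ̄_pˣ` and ANY root system `x` (F3c-2's `kummerZH x hu`), in particular for `q̈ = p` / `kappaP`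
(abc-iut-L2-t1's `fieldKN ⊥ (↑u) N = ℚ_p(μ_N, all N-th roots of u)`), and PACKAGES the level-`N` triviality locus as an
`OpenSubgroup (GQp p)` EXISTENCE statement — the literal shape of the hypothesis
`hloc : ∀ N, ∃ U : OpenSubgroup (GQp p), ∀ σ ∈ U, …` of abc-iut-w5-d249's generic twisted products (F4, abc-iut-L6-d6's
RULING R100 (1)) at STAGE 2, where `Φ σ = affTwist₃ ⟨((κ_p σ)^i, (κ_p σ)^j), χ σ⟩` is `ĥ_N`-trivial as soon as
`levelChar N (χ σ) = 1` and `level N ((κ_p σ)^i) = level N ((κ_p σ)^j) = 1` (abc-iut-L2-t6's `hHat_affTwist₃_of_level`):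

* `level_kummerZH_eq_one_of_mem_fixingSubgroup` (any base `K`);
* **`mem_fixingSubgroup_fieldKN_units_iff : σ ∈ G_{ℚ_p(μ_N, u^{1/N})} ↔ χ_N(σ) = 1 ∧ level N (κ_x σ) = 1`**;
* `isOpen_fixingSubgroup_fieldKN_units` (no finite-dimensionality input);
* **`exists_openSubgroup_chi_kummerZH_trivial N : ∃ U : OpenSubgroup (GQp p), ∀ σ ∈ U, χ_N(σ) = 1 ∧
  level N (κ_x σ) = 1 ∧ ∀ i : ℤ, level N ((κ_x σ)^i) = 1`** and its instances `exists_openSubgroup_chi_kappaP_trivial`,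
  `exists_openSubgroup_chi_kappaQ_trivial`;
* `natCast_eq_level_kummerZH_of_apply_root` — if `σ(u^{1/N}) = ξ_N^m · u^{1/N}` then `m ≡ κ_x(σ) (mod N)` (the
  `∀ m, aug g r = ζ^m r → …` shape of the origin clause `IsTateOrigin.tate` (c)).

A model is consistency evidence only; nothing here bears on [IUTchIII] Cor. 3.12.
-/

noncomputable section

open CategoryTheory ProfiniteGrp ProfiniteGrp.ProfiniteCompletion

namespace Literature.AnabelianGeometry.EtaleTheta.SettingModel

open Literature.AnabelianGeometry.SemiGraphs (GQp)

variable (p : ℕ) [Fact p.Prime]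

/-- `σ ∈ G_{K_N}` ⇒ `χ_N(σ) = 1`, for ANY base field `K ⊆ ℚ̄_p` and ANY `q` (`μ_N ⊆ K_N = K(μ_N, q^{1/N})`).  A private
copy (local helper) of abc-iut-L2-t1's public `levelChar_chi_eq_one_of_mem_fixingSubgroup_fieldKN`
(`SettingModelChiCoverings`, p429594), kept private so that this generic Kummer file stays below the χ-coverings in the
import graph; consumers should cite the public one. [cite: MochizukiEtTh2009, §1 p.13] -/
private theorem levelChar_chi_eq_one_of_mem_fixingSubgroup_fieldKN_aux (K : IntermediateField ℚ_[p] (PadicAlgCl p))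
    (q : PadicAlgCl p) {σ : GQp p} {N : ℕ+} (h : σ ∈ (fieldKN K q N).fixingSubgroup) :
    ZHatLevel.levelChar N (chi p σ) = 1 := by
  have hξ := isPrimitiveRoot_coe_cycGen p N
  have hfix : σ (((cycGen p : ℕ+ → (PadicAlgCl p)ˣ) N : (PadicAlgCl p)ˣ) : PadicAlgCl p) =
      (((cycGen p : ℕ+ → (PadicAlgCl p)ˣ) N : (PadicAlgCl p)ˣ) : PadicAlgCl p) ^ (1 : ℕ) := by
    rw [pow_one]
    refine (IntermediateField.mem_fixingSubgroup_iff _ _).mp h _ (IntermediateField.subset_adjoin _ _ ?_)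
    exact Set.mem_union_right _ (Or.inl hξ.pow_eq_one)
  rw [levelChar_chi_eq_of_isPrimitiveRoot p σ N hξ hfix, Nat.cast_one]

section Units

variable {p}
variable {u : (PadicAlgCl p)ˣ} (x : RootSystem u)
  (hu : u ∈ MulAction.fixedPoints (⊤ : Subgroup (GQp p)) (PadicAlgCl p)ˣ)

/-- `σ ∈ G_{K(μ_N, u^{1/N})}` ⇒ `κ_x(σ) ≡ 0 (mod N)` (the chosen `u^{1/N}` lies in the field), for any base `K`.
[cite: MochizukiEtTh2009, §1 p.13] -/
theorem level_kummerZH_eq_one_of_mem_fixingSubgroup (K : IntermediateField ℚ_[p] (PadicAlgCl p)) {σ : GQp p}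
    {N : ℕ+} (h : σ ∈ (fieldKN K (u : PadicAlgCl p) N).fixingSubgroup) :
    ZHatLevel.level N (kummerZH x hu σ) = 1 := by
  rw [level_kummerZH_eq_one_iff]
  refine (IntermediateField.mem_fixingSubgroup_iff _ _).mp h _ (IntermediateField.subset_adjoin _ _ ?_)
  refine Set.mem_union_right _ (Or.inr ?_)
  have hx := congrArg (fun w : (PadicAlgCl p)ˣ => (w : PadicAlgCl p)) (x.pow_self N)
  simpa only [Units.val_pow_eq_pow_val] using hx

/-- Every `N`-th root of `u` is the chosen one times an `N`-th root of unity. [cite: NeukirchANT1999, Ch. IV §3] -/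
theorem div_root_pow_eq_one {N : ℕ+} {s : PadicAlgCl p} (hs : s ^ (N : ℕ) = (u : PadicAlgCl p)) :
    (s / ((x.root N : (PadicAlgCl p)ˣ) : PadicAlgCl p)) ^ (N : ℕ) = 1 := by
  have hx := congrArg (fun w : (PadicAlgCl p)ˣ => (w : PadicAlgCl p)) (x.pow_self N)
  simp only [Units.val_pow_eq_pow_val] at hx
  rw [div_pow, hs, hx]
  exact div_self u.ne_zero

/-- **`G_{ℚ_p(μ_N, u^{1/N})} = {σ | χ_N(σ) = 1 ∧ κ_x(σ) ≡ 0 (N)}`** for ANY `G_{ℚ_p}`-fixed unit `u` and ANY root system `x`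
of `u` (F3c's `mem_fixingSubgroup_fieldKN_iff` was the instance `u = q = p²`, `x = qRoots p`). [cite: MochizukiEtTh2009, §1 p.13] -/
theorem mem_fixingSubgroup_fieldKN_units_iff (σ : GQp p) (N : ℕ+) :
    σ ∈ (fieldKN ⊥ (u : PadicAlgCl p) N).fixingSubgroup ↔
      ZHatLevel.levelChar N (chi p σ) = 1 ∧ ZHatLevel.level N (kummerZH x hu σ) = 1 := by
  refine ⟨fun h => ⟨levelChar_chi_eq_one_of_mem_fixingSubgroup_fieldKN_aux p ⊥ _ h,
    level_kummerZH_eq_one_of_mem_fixingSubgroup x hu ⊥ h⟩, fun h => ?_⟩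
  obtain ⟨hχ, hκ⟩ := h
  rw [level_kummerZH_eq_one_iff] at hκ
  have hμ : ∀ μ : PadicAlgCl p, μ ^ (N : ℕ) = 1 → σ μ = μ := by
    intro μ hμ
    rw [apply_eq_pow_levelChar_chi p σ N hμ, hχ, ZMod.val_one_eq_one_mod, ← pow_eq_pow_mod 1 hμ, pow_one]
  refine mem_fixingSubgroup_adjoin_of_forall p fun s hs => ?_
  rcases hs with hs | hs | hs
  · obtain ⟨r, rfl⟩ := IntermediateField.mem_bot.mp hs
    exact σ.commutes r
  · exact hμ s hs
  · have hr0 : ((x.root N : (PadicAlgCl p)ˣ) : PadicAlgCl p) ≠ 0 := (x.root N).ne_zero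
    have hs' : s = ((x.root N : (PadicAlgCl p)ˣ) : PadicAlgCl p) * (s / ((x.root N : (PadicAlgCl p)ˣ) : PadicAlgCl p)) := by
      rw [← mul_div_assoc, mul_comm, mul_div_assoc, div_self hr0, mul_one]
    rw [hs', map_mul, hκ, hμ _ (div_root_pow_eq_one x hs)]

include hu in
/-- **`G_{ℚ_p(μ_N, u^{1/N})}` is open in `G_{ℚ_p}`** — intersection of two fibres of locally constant maps (no
finite-dimensionality input). [cite: NeukirchANT1999, Ch. IV §1] -/
theorem isOpen_fixingSubgroup_fieldKN_units (N : ℕ+) :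
    IsOpen (((fieldKN ⊥ (u : PadicAlgCl p) N).fixingSubgroup : Subgroup (GQp p)) : Set (GQp p)) := by
  let x₀ : RootSystem u := RootSystem.ofRootableBy u
  have hset : (((fieldKN ⊥ (u : PadicAlgCl p) N).fixingSubgroup : Subgroup (GQp p)) : Set (GQp p)) =
      {σ : GQp p | ZHatLevel.levelChar N (chi p σ) = 1} ∩
        {σ : GQp p | ZHatLevel.level N (kummerZH x₀ hu σ) = 1} := by
    ext σ
    exact mem_fixingSubgroup_fieldKN_units_iff x₀ hu σ N
  rw [hset]
  exact (isOpen_setOf_levelChar_chi_eq_one p N).inter (isOpen_setOf_level_kummerZH_eq x₀ hu N 1)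

/-- **The `hloc` package.**  For every `N` there is an OPEN SUBGROUP `U ≤ G_{ℚ_p}` (namely `G_{ℚ_p(μ_N, u^{1/N})}`) on
which `χ_N = 1`, `κ_x ≡ 0 (N)` and hence every power `κ_x^i` is level-`N`-trivial — the literal shape of the
local-triviality hypothesis of the χ-twisted semidirect products at stage 2. [cite: NeukirchANT1999, Ch. IV §1] -/
theorem exists_openSubgroup_chi_kummerZH_trivial (N : ℕ+) :
    ∃ U : OpenSubgroup (GQp p), ∀ σ ∈ U,
      ZHatLevel.levelChar N (chi p σ) = 1 ∧ ZHatLevel.level N (kummerZH x hu σ) = 1 ∧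
        ∀ i : ℤ, ZHatLevel.level N (kummerZH x hu σ ^ i) = 1 := by
  refine ⟨⟨(fieldKN ⊥ (u : PadicAlgCl p) N).fixingSubgroup, isOpen_fixingSubgroup_fieldKN_units hu N⟩,
    fun σ hσ => ?_⟩
  obtain ⟨hχ, hκ⟩ := (mem_fixingSubgroup_fieldKN_units_iff x hu σ N).mp hσ
  exact ⟨hχ, hκ, fun i => by rw [map_zpow, hκ, one_zpow]⟩

/-- **Reading off `κ_x(σ) mod N` from ANY exponent**: if `σ(u^{1/N}) = ξ_N^m · u^{1/N}` for some `m : ℕ`, then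
`m ≡ κ_x(σ) (mod N)` — the shape in which the origin clause `IsTateOrigin.tate` (c) quantifies ("`aug g r = ζ^m · r →
…`"). [cite: NeukirchANT1999, Ch. IV §3] -/
theorem natCast_eq_level_kummerZH_of_apply_root {σ : GQp p} {N : ℕ+} {m : ℕ}
    (h : σ ((x.root N : (PadicAlgCl p)ˣ) : PadicAlgCl p) =
      (((cycGen p : ℕ+ → (PadicAlgCl p)ˣ) N : (PadicAlgCl p)ˣ) : PadicAlgCl p) ^ m *
        ((x.root N : (PadicAlgCl p)ˣ) : PadicAlgCl p)) :
    (m : ZMod N) = Multiplicative.toAdd (ZHatLevel.level N (kummerZH x hu σ)) := by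
  haveI : NeZero (N : ℕ) := ⟨N.ne_zero⟩
  have hξ := isPrimitiveRoot_coe_cycGen p N
  have h2 := apply_root_eq x hu σ N
  rw [h] at h2
  have h3 := mul_right_cancel₀ (x.root N).ne_zero h2
  rw [pow_eq_pow_mod m hξ.pow_eq_one] at h3
  have h4 := hξ.pow_inj (Nat.mod_lt _ N.pos) (ZMod.val_lt _) h3
  rw [← ZMod.natCast_mod, h4, ZMod.natCast_zmod_val]

include hu in
/-- Conversely the canonical exponent works: `σ(u^{1/N}) = ξ_N^{(κ_x σ mod N).val} · u^{1/N}` (F3c-2's `apply_root_eq`,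
restated in the clause's `∃ m` shape). [cite: NeukirchANT1999, Ch. IV §3] -/
theorem exists_apply_root_eq_pow_mul (σ : GQp p) (N : ℕ+) :
    ∃ m : ℕ, σ ((x.root N : (PadicAlgCl p)ˣ) : PadicAlgCl p) =
      (((cycGen p : ℕ+ → (PadicAlgCl p)ˣ) N : (PadicAlgCl p)ˣ) : PadicAlgCl p) ^ m *
        ((x.root N : (PadicAlgCl p)ˣ) : PadicAlgCl p) :=
  ⟨_, apply_root_eq x hu σ N⟩

end Units

/-- `m ≡ κ_p(σ) (mod N)` whenever `σ(p^{1/N}) = ξ_N^m · p^{1/N}`. [cite: NeukirchANT1999, Ch. IV §3] -/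
theorem natCast_eq_level_kappaP_of_apply_pRoot {σ : GQp p} {N : ℕ+} {m : ℕ}
    (h : σ (pRoot p N) = (((cycGen p : ℕ+ → (PadicAlgCl p)ˣ) N : (PadicAlgCl p)ˣ) : PadicAlgCl p) ^ m * pRoot p N) :
    (m : ZMod N) = Multiplicative.toAdd (ZHatLevel.level N (kappaP p σ)) :=
  natCast_eq_level_kummerZH_of_apply_root (pRoots p) (pUnit_mem_fixedPoints p) h

/-- `hloc` for `κ_p` (`q̈ = p`, roots `pRoots p`): an open subgroup on which `χ_N = 1` and all `κ_p^i ≡ 0 (N)`.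
[cite: NeukirchANT1999, Ch. IV §1] -/
theorem exists_openSubgroup_chi_kappaP_trivial (N : ℕ+) :
    ∃ U : OpenSubgroup (GQp p), ∀ σ ∈ U,
      ZHatLevel.levelChar N (chi p σ) = 1 ∧ ZHatLevel.level N (kappaP p σ) = 1 ∧
        ∀ i : ℤ, ZHatLevel.level N (kappaP p σ ^ i) = 1 :=
  exists_openSubgroup_chi_kummerZH_trivial (pRoots p) (pUnit_mem_fixedPoints p) N

/-- `G_{ℚ_p(μ_N, p^{1/N})} = {χ_N = 1 ∧ κ_p ≡ 0 (N)}` (the `K̈`-type field cut out by `q̈ = p`).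
[cite: MochizukiEtTh2009, §1 p.17] -/
theorem mem_fixingSubgroup_fieldKN_p_iff (σ : GQp p) (N : ℕ+) :
    σ ∈ (fieldKN ⊥ ((p : ℕ) : PadicAlgCl p) N).fixingSubgroup ↔
      ZHatLevel.levelChar N (chi p σ) = 1 ∧ ZHatLevel.level N (kappaP p σ) = 1 := by
  rw [← coe_pUnit]
  exact mem_fixingSubgroup_fieldKN_units_iff (pRoots p) (pUnit_mem_fixedPoints p) σ N

/-- `hloc` for F3c's `κ_q` (`q = p²`, roots `qRoots p`). [cite: NeukirchANT1999, Ch. IV §1] -/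
theorem exists_openSubgroup_chi_kappaQ_trivial (N : ℕ+) :
    ∃ U : OpenSubgroup (GQp p), ∀ σ ∈ U,
      ZHatLevel.levelChar N (chi p σ) = 1 ∧ ZHatLevel.level N (kappaQ p σ) = 1 ∧
        ∀ i : ℤ, ZHatLevel.level N (kappaQ p σ ^ i) = 1 := by
  obtain ⟨U, hU⟩ := exists_openSubgroup_chi_kummerZH_trivial (qRoots p)
    (mem_fixedPoints_top_of_forall (smul_qUnit p)) N
  refine ⟨U, fun σ hσ => ?_⟩
  rw [kappaQ_eq_kummerZH]
  exact hU σ hσ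

end Literature.AnabelianGeometry.EtaleTheta.SettingModel

end
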